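import Summits.QuantumFields.BalabanUV.Beta.EriceRemainderEnclosureHistoryAutonomyComparisonAgeCompositionTwoClusterLevels
import Summits.QuantumFields.BalabanUV.Beta.EriceRemainderEnclosureHistoryAutonomyComparisonAgeCompositionOldTripleCapC22
import Summits.QuantumFields.BalabanUV.Beta.EriceRemainderEnclosureHistoryAutonomyComparisonAgeCompositionOldTripleCapC23
import Summits.QuantumFields.BalabanUV.Beta.EriceRemainderEnclosureHistoryAutonomyComparisonAgeCompositionOldTripleCapC32
import Summits.QuantumFields.BalabanUV.Beta.EriceRemainderEnclosureHistoryAutonomyComparisonAgeCompositionOldTripleCapC24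
import Summits.QuantumFields.BalabanUV.Beta.EriceRemainderEnclosureHistoryAutonomyComparisonAgeCompositionOldTripleCapC42
import Summits.QuantumFields.BalabanUV.Beta.EriceRemainderEnclosureHistoryAutonomyComparisonAgeCompositionOldTripleCapC33
import Summits.QuantumFields.BalabanUV.Beta.EriceRemainderEnclosureHistoryAutonomyComparisonAgeCompositionOldTripleCapC34
import Summits.QuantumFields.BalabanUV.Beta.EriceRemainderEnclosureHistoryAutonomyComparisonAgeCompositionOldTripleCapC43
import Summits.QuantumFields.BalabanUV.Beta.EriceRemainderEnclosureHistoryAutonomyComparisonAgeCompositionOldTripleCapC44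

/-!
# EriceRemainderEnclosureHistoryAutonomyComparisonAgeCompositionFiveAgesOneBlock — (E104a) route (N), first order: THE CENSUS FIVE AGES `{1, k₂, k₃, k₄, k₅}`, BOTH TOP RATIOS AT MOST 4.
# The cascade's last step is cheap ((E99g) `flow_nonneg_two_cluster_levels_of_caps`: a capped youngest cluster and ONE capped top cluster close with
# `s₀(ρ₀λ + 4s(1+κ) + κ) ≤ ρ₀λ`, `λ = 1 − s(1+κ)`, any `κ > 0`).  With the youngest cluster the census young pair `{1, k₂}` (`k₂ ≤ 29`, cap `0.8333`,
# (E97c)) and the top cluster the OLD TRIPLE `{k₃, k₄, k₅}` capped by the cell tables of (E103e–zb), the census five ages hold along every admissible flow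
# for EVERY `(k₄∕k₃, k₅∕k₄)` in the cell once `k₃ ≥ ρ₀·k₂`, `ρ₀ = ⌈0.8333(4s(1+κ)+κ)∕(λ·0.1667)⌉` at `κ = 1∕1000`:
# # `flow_nonneg_census_five_ages_c22` (ρ₀ = 61); `flow_nonneg_census_five_ages_c23` (ρ₀ = 61); `flow_nonneg_census_five_ages_c32` (ρ₀ = 61); `flow_nonneg_census_five_ages_c24` (ρ₀ = 61); `flow_nonneg_census_five_ages_c42` (ρ₀ = 64); `flow_nonneg_census_five_ages_c33` (ρ₀ = 64); `flow_nonneg_census_five_ages_c34` (ρ₀ = 68); `flow_nonneg_census_five_ages_c43` (ρ₀ = 68); `flow_nonneg_census_five_ages_c44` (ρ₀ = 68);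
# **`flow_nonneg_census_five_ages_top4`**: EVERY `k₃ < k₄ ≤ 4k₃`, `k₄ < k₅ ≤ 4k₄` once `68k₂ ≤ k₃`.
# (numerics `HOME/b2b-balaban-beta-d4-p2/g89/numerics/five_certified.py`: the adaptive engine (E101) with three separate old levels would lower the
# larger `ρ₀` of the wide cells to `≈ 45–75`; not typed here).

Cell `pub-balaban`, β-function sub-cell, BINDER row D4 «RemainderConst leaves for Bałaban's split» (`HOME/BINDER-OWNERS.md`; owner lineage `b2b-balaban-beta-an4`;
this file by co-owner #2 lineage `b2b-balaban-beta-d4-p2`, generation 89), β-FLOW TEAM duty (1), FREEZE (0) honoured (def-free; nothing restated).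

HONEST FRAMING (page 1, verbatim and binding).  *"Discharging BetaPertH makes Bałaban's UV stability UNCONDITIONAL — a real constructive-QFT result; it is
NOT the continuum limit and NOT the Clay problem."*  THIS FILE DISCHARGES NOTHING OF THE KIND.  Elementary real algebra ∕ real analysis about ABSTRACT
functionals on a box ]0,γ]^ℕ with displayed floors, profiles and signs, and the FIRST-ORDER renewal objects of route (N) built from them — hypotheses of a
census, not facts; the form, signs, ages and moments of Bałaban's (1.22) limit functional are NOT PRINTED ([I] p. 298; GAPS G-t4-U2-1∕-2) and NOT asserted.
Row D4 class UNCHANGED (critical-path width 0; instance 0∕1; D4 DISCHARGE NO DATE).  HONEST DEPENDENCY: continuum YM on T⁴ ⇐ BetaPertH ∧ nine spine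
estimates (0/9 proved); BetaPertH ⇐ (D1) ∧ (D4) ∧ CAP+tail; G-an2-4 gates asym, D1 and NE2/3/4.

THE POINT (README `HOME/b2b-balaban-beta-d4-p2/g89/README.md` §4).  Uses (E99g) `flow_nonneg_two_cluster_levels_of_caps`, (E97c) `young_pair_load_le`, (E103f–m, e) `old_triple_load_le_c22 … c44` BY NAME.  NOT CLAIMED: `k₂ ≥ 30`; `k₃ < ρ₀k₂`; the cell `(8,16]²`; six or
more ages; anything printed — NOT B12 Thm 2, NOT BetaPertH, NOT continuum, NOT Clay.

WHAT IS PROVED ([folklore]; 0 `def`, 0 sorry).  See the list above.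
-/
noncomputable section
open Finset

namespace Summit.QuantumFields.BalabanUV.Beta.EriceRemainderEnclosureHistoryAutonomyComparisonAgeCompositionFiveAgesOneBlock

open Literature.MathematicalPhysics.QuantumFieldTheory.Balaban1983to89
open Literature.MathematicalPhysics.QuantumFieldTheory.Balaban1983to89.T4BetaStationary
open Literature.MathematicalPhysics.QuantumFieldTheory.Balaban1983to89.T4BetaFlowWellPosed
open Summit.QuantumFields.BalabanUV.Beta.EriceRemainderEnclosureHistoryAutonomyComparisonAgeCompositionTwoClusterLevels (flow_nonneg_two_cluster_levels_of_caps)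
open Summit.QuantumFields.BalabanUV.Beta.EriceRemainderEnclosureHistoryAutonomyComparisonAgeCompositionYoungPairCapSeparatedAges (young_pair_load_le)
open Summit.QuantumFields.BalabanUV.Beta.EriceRemainderEnclosureHistoryAutonomyComparisonAgeCompositionOldTripleCapC22 (old_triple_load_le_c22)
open Summit.QuantumFields.BalabanUV.Beta.EriceRemainderEnclosureHistoryAutonomyComparisonAgeCompositionOldTripleCapC23 (old_triple_load_le_c23)
open Summit.QuantumFields.BalabanUV.Beta.EriceRemainderEnclosureHistoryAutonomyComparisonAgeCompositionOldTripleCapC32 (old_triple_load_le_c32)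
open Summit.QuantumFields.BalabanUV.Beta.EriceRemainderEnclosureHistoryAutonomyComparisonAgeCompositionOldTripleCapC24 (old_triple_load_le_c24)
open Summit.QuantumFields.BalabanUV.Beta.EriceRemainderEnclosureHistoryAutonomyComparisonAgeCompositionOldTripleCapC42 (old_triple_load_le_c42)
open Summit.QuantumFields.BalabanUV.Beta.EriceRemainderEnclosureHistoryAutonomyComparisonAgeCompositionOldTripleCapC33 (old_triple_load_le_c33)
open Summit.QuantumFields.BalabanUV.Beta.EriceRemainderEnclosureHistoryAutonomyComparisonAgeCompositionOldTripleCapC34 (old_triple_load_le_c34)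
open Summit.QuantumFields.BalabanUV.Beta.EriceRemainderEnclosureHistoryAutonomyComparisonAgeCompositionOldTripleCapC43 (old_triple_load_le_c43)
open Summit.QuantumFields.BalabanUV.Beta.EriceRemainderEnclosureHistoryAutonomyComparisonAgeCompositionOldTripleCapC44 (old_triple_load_le_c44)

variable {B : (ℕ → ℝ) → ℝ} {γ b gIR : ℝ} {L : ℕ → ℝ} {K : ℕ} {h g : ℕ → ℝ}

/-! ## §1 The census young pair below one capped old triple (parametric) -/

/-- **THE CENSUS YOUNG PAIR BELOW ONE CAPPED OLD TRIPLE (parametric).**  Ages `{1, k₂, k₃, k₄, k₅}`, `2 ≤ k₂ ≤ 29`, `k₂ < k₃ < k₄ < k₅ < K`, the profile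
vanishing elsewhere; a TRIPLE CAP `x_{k₃}(q) + x_{k₄}(q) + x_{k₅}(q) ≤ s` at every pin (hypothesis — the cell tables (E103e–zb)); closure of (E99g): `κ > 0`,
`0 ≤ s`, `s(1+κ) < 1`, `ρ₀ ≥ 1`, `0.8333·(ρ₀(1 − s(1+κ)) + 4s(1+κ) + κ) ≤ ρ₀(1 − s(1+κ))`, and the gap `ρ₀·k₂ ≤ k₃`.  THEN `0 ≤ ε ≤ e` at every pin,
every horizon, every damping of the self-consistent class ((E99g) `flow_nonneg_two_cluster_levels_of_caps` with `S₀ = {1,k₂}` (cap `0.8333`, (E97c)) and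
`S₁ = {k₃,k₄,k₅}`). [folklore] -/
theorem flow_nonneg_census_young_pair_old_triple_of_cap
    (hmono : ∀ u v : ℕ → ℝ, SeqBox γ u → SeqBox γ v → (∀ j, u j ≤ v j) → B u ≤ B v)
    (hL : ∀ k, 0 ≤ L k) (hb : 0 < b) (hlo : ∀ u, SeqBox γ u → b ≤ B u) (hdom : ∀ u, SeqBox γ u → ∑ k ∈ range K, L k * u k ≤ B u)
    (hh : SeqBox γ h) (hf : MemFlow B gIR h) (hg : ∀ t, 0 < g t ∧ g t ≤ 1)
    (hgF : ∀ t, 1 ≤ g t * (1 + ∑ k ∈ range K, L k * h (t + k) ^ 3 / 2))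
    {k₂ k₃ k₄ k₅ : ℕ} (hk2 : 2 ≤ k₂) (hk29 : k₂ ≤ 29) (hk23 : k₂ < k₃) (hk34 : k₃ < k₄) (hk45 : k₄ < k₅) (hk5K : k₅ < K)
    {κ s : ℝ} {ρ₀ : ℕ} (hκ : 0 < κ) (hs : 0 ≤ s) (hsC : s * (1 + κ) < 1) (hρ₀ : 1 ≤ ρ₀)
    (hyoung : (8333 / 10000 : ℝ) * ((ρ₀ : ℝ) * (1 - s * (1 + κ)) + (4 * s * (1 + κ) + κ)) ≤ (ρ₀ : ℝ) * (1 - s * (1 + κ)))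
    (hgap : ρ₀ * k₂ ≤ k₃)
    (htri : ∀ q : ℕ, (k₃ : ℝ) * (L k₃ * h (q + k₃) ^ 3 / 2) + (k₄ : ℝ) * (L k₄ * h (q + k₄) ^ 3 / 2) + (k₅ : ℝ) * (L k₅ * h (q + k₅) ^ 3 / 2) ≤ s)
    (hLa : ∀ l, l < K → l ≠ 1 → l ≠ k₂ → l ≠ k₃ → l ≠ k₄ → l ≠ k₅ → L l = 0)
    {N : ℕ} {KL : ℕ → ℕ → ℕ → ℝ}
    (hKL : ∀ k n l, KL k n l = if 0 < k ∧ k < K ∧ l < k then L k * h (n + k) ^ 3 / 2 * ∏ t ∈ Ico (n + 1 + l) (n + k + 1), g t else 0)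
    {KA : ℕ → ℕ → ℕ → ℝ} {RA : ℕ → (ℕ → ℝ) → ℕ → ℝ}
    (hRA : ∀ i v m, RA i v m = ∑ l ∈ range K, KA i m l * v (m + 1 + l))
    (hKA : ∀ i m l, KA i m l = KL i m l + KA (i + 1) m l) (hKAtop : ∀ m l, KA K m l = 0)
    {e ε : ℕ → ℝ} (he0 : ∀ m, 0 ≤ e m) (hea : ∀ m, e (m + 1) ≤ e m)
    (hεt : ∀ m, N < m → ε m = 0) (hεrec : ∀ m, ε m = e m - RA 1 ε m) : ∀ m, 0 ≤ ε m ∧ ε m ≤ e m := by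
  refine flow_nonneg_two_cluster_levels_of_caps hmono hL hb hlo hdom hh hf hg hgF (by omega) hκ hs hsC hρ₀ hyoung
    (S₀ := {1, k₂}) (S₁ := {k₃, k₄, k₅}) (hi₀ := k₂) (lo₁ := k₃) (hi₁ := k₅)
    (fun k hk => ?_) (fun k hk => ?_) (fun k hk => ?_) (fun k hk => ?_) (fun k hk => ?_) (by omega) hgap (fun x hx y hy => ?_)
    (fun l hl h0 h1 => ?_) (fun q => ?_) (fun q => ?_) hKL hRA hKA hKAtop he0 hea hεt hεrec
  · simp only [mem_insert, mem_singleton] at hk; rcases hk with rfl | rfl <;> omega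
  · simp only [mem_insert, mem_singleton] at hk; rcases hk with rfl | rfl <;> omega
  · simp only [mem_insert, mem_singleton] at hk; rcases hk with rfl | rfl | rfl <;> omega
  · simp only [mem_insert, mem_singleton] at hk; rcases hk with rfl | rfl | rfl <;> omega
  · simp only [mem_insert, mem_singleton] at hk; rcases hk with rfl | rfl | rfl <;> omega
  · simp only [mem_insert, mem_singleton] at hx hy
    rcases hx with rfl | rfl <;> rcases hy with rfl | rfl | rfl <;> omega
  · refine hLa l hl (fun he => h0 ?_) (fun he => h0 ?_) (fun he => h1 ?_) (fun he => h1 ?_) (fun he => h1 ?_)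
    · rw [he]; exact mem_insert_self _ _
    · rw [he]; exact mem_insert_of_mem (mem_singleton_self _)
    · rw [he]; exact mem_insert_self _ _
    · rw [he]; exact mem_insert_of_mem (mem_insert_self _ _)
    · rw [he]; exact mem_insert_of_mem (mem_insert_of_mem (mem_singleton_self _))
  · rw [sum_pair (show (1 : ℕ) ≠ k₂ by omega), Nat.cast_one, one_mul]
    exact young_pair_load_le hmono hL hb hlo hdom hh hf hk2 hk29 (by omega) q
  · rw [sum_insert (by simp; omega), sum_pair (show k₄ ≠ k₅ by omega)]
    have := htri q
    linarith

/-! ## §2 The cells with both top ratios at most 4 -/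

/-- **THE CENSUS FIVE AGES `{1, k₂, k₃, k₄, k₅}` ON THE CELL `k₄∕k₃ ∈ (1,2]`, `k₅∕k₄ ∈ (1,2]`:** `2 ≤ k₂ ≤ 29`, `61·k₂ ≤ k₃`: `0 ≤ ε ≤ e` at
every pin, every horizon, every damping of the self-consistent class (§1 with the triple cap `3 / 4` of `old_triple_load_le_c22`, `κ = 1∕1000`,
`ρ₀ = 61`). [folklore] -/
theorem flow_nonneg_census_five_ages_c22
    (hmono : ∀ u v : ℕ → ℝ, SeqBox γ u → SeqBox γ v → (∀ j, u j ≤ v j) → B u ≤ B v)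
    (hL : ∀ k, 0 ≤ L k) (hb : 0 < b) (hlo : ∀ u, SeqBox γ u → b ≤ B u) (hdom : ∀ u, SeqBox γ u → ∑ k ∈ range K, L k * u k ≤ B u)
    (hh : SeqBox γ h) (hf : MemFlow B gIR h) (hg : ∀ t, 0 < g t ∧ g t ≤ 1)
    (hgF : ∀ t, 1 ≤ g t * (1 + ∑ k ∈ range K, L k * h (t + k) ^ 3 / 2))
    {k₂ k₃ k₄ k₅ : ℕ} (hk2 : 2 ≤ k₂) (hk29 : k₂ ≤ 29) (hk3 : 61 * k₂ ≤ k₃)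
    (h34l : 1 * k₃ < k₄) (h34h : k₄ ≤ 2 * k₃) (h45l : 1 * k₄ < k₅) (h45h : k₅ ≤ 2 * k₄) (hk5K : k₅ < K)
    (hLa : ∀ l, l < K → l ≠ 1 → l ≠ k₂ → l ≠ k₃ → l ≠ k₄ → l ≠ k₅ → L l = 0)
    {N : ℕ} {KL : ℕ → ℕ → ℕ → ℝ}
    (hKL : ∀ k n l, KL k n l = if 0 < k ∧ k < K ∧ l < k then L k * h (n + k) ^ 3 / 2 * ∏ t ∈ Ico (n + 1 + l) (n + k + 1), g t else 0)
    {KA : ℕ → ℕ → ℕ → ℝ} {RA : ℕ → (ℕ → ℝ) → ℕ → ℝ}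
    (hRA : ∀ i v m, RA i v m = ∑ l ∈ range K, KA i m l * v (m + 1 + l))
    (hKA : ∀ i m l, KA i m l = KL i m l + KA (i + 1) m l) (hKAtop : ∀ m l, KA K m l = 0)
    {e ε : ℕ → ℝ} (he0 : ∀ m, 0 ≤ e m) (hea : ∀ m, e (m + 1) ≤ e m)
    (hεt : ∀ m, N < m → ε m = 0) (hεrec : ∀ m, ε m = e m - RA 1 ε m) : ∀ m, 0 ≤ ε m ∧ ε m ≤ e m :=
  flow_nonneg_census_young_pair_old_triple_of_cap hmono hL hb hlo hdom hh hf hg hgF hk2 hk29 (by omega) (by omega) (by omega) hk5K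
    (s := 3 / 4) (κ := 1 / 1000) (ρ₀ := 61) (by norm_num) (by norm_num) (by norm_num) (by norm_num) (by norm_num) hk3
    (fun q => old_triple_load_le_c22 hmono hL hb hlo hdom hh hf (by omega) h34l h34h h45l h45h hk5K q) hLa hKL hRA hKA hKAtop he0 hea hεt hεrec

/-- **THE CENSUS FIVE AGES `{1, k₂, k₃, k₄, k₅}` ON THE CELL `k₄∕k₃ ∈ (1,2]`, `k₅∕k₄ ∈ (2,3]`:** `2 ≤ k₂ ≤ 29`, `61·k₂ ≤ k₃`: `0 ≤ ε ≤ e` at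
every pin, every horizon, every damping of the self-consistent class (§1 with the triple cap `3 / 4` of `old_triple_load_le_c23`, `κ = 1∕1000`,
`ρ₀ = 61`). [folklore] -/
theorem flow_nonneg_census_five_ages_c23
    (hmono : ∀ u v : ℕ → ℝ, SeqBox γ u → SeqBox γ v → (∀ j, u j ≤ v j) → B u ≤ B v)
    (hL : ∀ k, 0 ≤ L k) (hb : 0 < b) (hlo : ∀ u, SeqBox γ u → b ≤ B u) (hdom : ∀ u, SeqBox γ u → ∑ k ∈ range K, L k * u k ≤ B u)
    (hh : SeqBox γ h) (hf : MemFlow B gIR h) (hg : ∀ t, 0 < g t ∧ g t ≤ 1)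
    (hgF : ∀ t, 1 ≤ g t * (1 + ∑ k ∈ range K, L k * h (t + k) ^ 3 / 2))
    {k₂ k₃ k₄ k₅ : ℕ} (hk2 : 2 ≤ k₂) (hk29 : k₂ ≤ 29) (hk3 : 61 * k₂ ≤ k₃)
    (h34l : 1 * k₃ < k₄) (h34h : k₄ ≤ 2 * k₃) (h45l : 2 * k₄ < k₅) (h45h : k₅ ≤ 3 * k₄) (hk5K : k₅ < K)
    (hLa : ∀ l, l < K → l ≠ 1 → l ≠ k₂ → l ≠ k₃ → l ≠ k₄ → l ≠ k₅ → L l = 0)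
    {N : ℕ} {KL : ℕ → ℕ → ℕ → ℝ}
    (hKL : ∀ k n l, KL k n l = if 0 < k ∧ k < K ∧ l < k then L k * h (n + k) ^ 3 / 2 * ∏ t ∈ Ico (n + 1 + l) (n + k + 1), g t else 0)
    {KA : ℕ → ℕ → ℕ → ℝ} {RA : ℕ → (ℕ → ℝ) → ℕ → ℝ}
    (hRA : ∀ i v m, RA i v m = ∑ l ∈ range K, KA i m l * v (m + 1 + l))
    (hKA : ∀ i m l, KA i m l = KL i m l + KA (i + 1) m l) (hKAtop : ∀ m l, KA K m l = 0)
    {e ε : ℕ → ℝ} (he0 : ∀ m, 0 ≤ e m) (hea : ∀ m, e (m + 1) ≤ e m)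
    (hεt : ∀ m, N < m → ε m = 0) (hεrec : ∀ m, ε m = e m - RA 1 ε m) : ∀ m, 0 ≤ ε m ∧ ε m ≤ e m :=
  flow_nonneg_census_young_pair_old_triple_of_cap hmono hL hb hlo hdom hh hf hg hgF hk2 hk29 (by omega) (by omega) (by omega) hk5K
    (s := 3 / 4) (κ := 1 / 1000) (ρ₀ := 61) (by norm_num) (by norm_num) (by norm_num) (by norm_num) (by norm_num) hk3
    (fun q => old_triple_load_le_c23 hmono hL hb hlo hdom hh hf (by omega) h34l h34h h45l h45h hk5K q) hLa hKL hRA hKA hKAtop he0 hea hεt hεrec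

/-- **THE CENSUS FIVE AGES `{1, k₂, k₃, k₄, k₅}` ON THE CELL `k₄∕k₃ ∈ (2,3]`, `k₅∕k₄ ∈ (1,2]`:** `2 ≤ k₂ ≤ 29`, `61·k₂ ≤ k₃`: `0 ≤ ε ≤ e` at
every pin, every horizon, every damping of the self-consistent class (§1 with the triple cap `3 / 4` of `old_triple_load_le_c32`, `κ = 1∕1000`,
`ρ₀ = 61`). [folklore] -/
theorem flow_nonneg_census_five_ages_c32
    (hmono : ∀ u v : ℕ → ℝ, SeqBox γ u → SeqBox γ v → (∀ j, u j ≤ v j) → B u ≤ B v)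
    (hL : ∀ k, 0 ≤ L k) (hb : 0 < b) (hlo : ∀ u, SeqBox γ u → b ≤ B u) (hdom : ∀ u, SeqBox γ u → ∑ k ∈ range K, L k * u k ≤ B u)
    (hh : SeqBox γ h) (hf : MemFlow B gIR h) (hg : ∀ t, 0 < g t ∧ g t ≤ 1)
    (hgF : ∀ t, 1 ≤ g t * (1 + ∑ k ∈ range K, L k * h (t + k) ^ 3 / 2))
    {k₂ k₃ k₄ k₅ : ℕ} (hk2 : 2 ≤ k₂) (hk29 : k₂ ≤ 29) (hk3 : 61 * k₂ ≤ k₃)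
    (h34l : 2 * k₃ < k₄) (h34h : k₄ ≤ 3 * k₃) (h45l : 1 * k₄ < k₅) (h45h : k₅ ≤ 2 * k₄) (hk5K : k₅ < K)
    (hLa : ∀ l, l < K → l ≠ 1 → l ≠ k₂ → l ≠ k₃ → l ≠ k₄ → l ≠ k₅ → L l = 0)
    {N : ℕ} {KL : ℕ → ℕ → ℕ → ℝ}
    (hKL : ∀ k n l, KL k n l = if 0 < k ∧ k < K ∧ l < k then L k * h (n + k) ^ 3 / 2 * ∏ t ∈ Ico (n + 1 + l) (n + k + 1), g t else 0)
    {KA : ℕ → ℕ → ℕ → ℝ} {RA : ℕ → (ℕ → ℝ) → ℕ → ℝ}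
    (hRA : ∀ i v m, RA i v m = ∑ l ∈ range K, KA i m l * v (m + 1 + l))
    (hKA : ∀ i m l, KA i m l = KL i m l + KA (i + 1) m l) (hKAtop : ∀ m l, KA K m l = 0)
    {e ε : ℕ → ℝ} (he0 : ∀ m, 0 ≤ e m) (hea : ∀ m, e (m + 1) ≤ e m)
    (hεt : ∀ m, N < m → ε m = 0) (hεrec : ∀ m, ε m = e m - RA 1 ε m) : ∀ m, 0 ≤ ε m ∧ ε m ≤ e m :=
  flow_nonneg_census_young_pair_old_triple_of_cap hmono hL hb hlo hdom hh hf hg hgF hk2 hk29 (by omega) (by omega) (by omega) hk5K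
    (s := 3 / 4) (κ := 1 / 1000) (ρ₀ := 61) (by norm_num) (by norm_num) (by norm_num) (by norm_num) (by norm_num) hk3
    (fun q => old_triple_load_le_c32 hmono hL hb hlo hdom hh hf (by omega) h34l h34h h45l h45h hk5K q) hLa hKL hRA hKA hKAtop he0 hea hεt hεrec

/-- **THE CENSUS FIVE AGES `{1, k₂, k₃, k₄, k₅}` ON THE CELL `k₄∕k₃ ∈ (1,2]`, `k₅∕k₄ ∈ (3,4]`:** `2 ≤ k₂ ≤ 29`, `61·k₂ ≤ k₃`: `0 ≤ ε ≤ e` at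
every pin, every horizon, every damping of the self-consistent class (§1 with the triple cap `3 / 4` of `old_triple_load_le_c24`, `κ = 1∕1000`,
`ρ₀ = 61`). [folklore] -/
theorem flow_nonneg_census_five_ages_c24
    (hmono : ∀ u v : ℕ → ℝ, SeqBox γ u → SeqBox γ v → (∀ j, u j ≤ v j) → B u ≤ B v)
    (hL : ∀ k, 0 ≤ L k) (hb : 0 < b) (hlo : ∀ u, SeqBox γ u → b ≤ B u) (hdom : ∀ u, SeqBox γ u → ∑ k ∈ range K, L k * u k ≤ B u)
    (hh : SeqBox γ h) (hf : MemFlow B gIR h) (hg : ∀ t, 0 < g t ∧ g t ≤ 1)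
    (hgF : ∀ t, 1 ≤ g t * (1 + ∑ k ∈ range K, L k * h (t + k) ^ 3 / 2))
    {k₂ k₃ k₄ k₅ : ℕ} (hk2 : 2 ≤ k₂) (hk29 : k₂ ≤ 29) (hk3 : 61 * k₂ ≤ k₃)
    (h34l : 1 * k₃ < k₄) (h34h : k₄ ≤ 2 * k₃) (h45l : 3 * k₄ < k₅) (h45h : k₅ ≤ 4 * k₄) (hk5K : k₅ < K)
    (hLa : ∀ l, l < K → l ≠ 1 → l ≠ k₂ → l ≠ k₃ → l ≠ k₄ → l ≠ k₅ → L l = 0)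
    {N : ℕ} {KL : ℕ → ℕ → ℕ → ℝ}
    (hKL : ∀ k n l, KL k n l = if 0 < k ∧ k < K ∧ l < k then L k * h (n + k) ^ 3 / 2 * ∏ t ∈ Ico (n + 1 + l) (n + k + 1), g t else 0)
    {KA : ℕ → ℕ → ℕ → ℝ} {RA : ℕ → (ℕ → ℝ) → ℕ → ℝ}
    (hRA : ∀ i v m, RA i v m = ∑ l ∈ range K, KA i m l * v (m + 1 + l))
    (hKA : ∀ i m l, KA i m l = KL i m l + KA (i + 1) m l) (hKAtop : ∀ m l, KA K m l = 0)
    {e ε : ℕ → ℝ} (he0 : ∀ m, 0 ≤ e m) (hea : ∀ m, e (m + 1) ≤ e m)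
    (hεt : ∀ m, N < m → ε m = 0) (hεrec : ∀ m, ε m = e m - RA 1 ε m) : ∀ m, 0 ≤ ε m ∧ ε m ≤ e m :=
  flow_nonneg_census_young_pair_old_triple_of_cap hmono hL hb hlo hdom hh hf hg hgF hk2 hk29 (by omega) (by omega) (by omega) hk5K
    (s := 3 / 4) (κ := 1 / 1000) (ρ₀ := 61) (by norm_num) (by norm_num) (by norm_num) (by norm_num) (by norm_num) hk3
    (fun q => old_triple_load_le_c24 hmono hL hb hlo hdom hh hf (by omega) h34l h34h h45l h45h hk5K q) hLa hKL hRA hKA hKAtop he0 hea hεt hεrec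

/-- **THE CENSUS FIVE AGES `{1, k₂, k₃, k₄, k₅}` ON THE CELL `k₄∕k₃ ∈ (3,4]`, `k₅∕k₄ ∈ (1,2]`:** `2 ≤ k₂ ≤ 29`, `64·k₂ ≤ k₃`: `0 ≤ ε ≤ e` at
every pin, every horizon, every damping of the self-consistent class (§1 with the triple cap `19 / 25` of `old_triple_load_le_c42`, `κ = 1∕1000`,
`ρ₀ = 64`). [folklore] -/
theorem flow_nonneg_census_five_ages_c42
    (hmono : ∀ u v : ℕ → ℝ, SeqBox γ u → SeqBox γ v → (∀ j, u j ≤ v j) → B u ≤ B v)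
    (hL : ∀ k, 0 ≤ L k) (hb : 0 < b) (hlo : ∀ u, SeqBox γ u → b ≤ B u) (hdom : ∀ u, SeqBox γ u → ∑ k ∈ range K, L k * u k ≤ B u)
    (hh : SeqBox γ h) (hf : MemFlow B gIR h) (hg : ∀ t, 0 < g t ∧ g t ≤ 1)
    (hgF : ∀ t, 1 ≤ g t * (1 + ∑ k ∈ range K, L k * h (t + k) ^ 3 / 2))
    {k₂ k₃ k₄ k₅ : ℕ} (hk2 : 2 ≤ k₂) (hk29 : k₂ ≤ 29) (hk3 : 64 * k₂ ≤ k₃)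
    (h34l : 3 * k₃ < k₄) (h34h : k₄ ≤ 4 * k₃) (h45l : 1 * k₄ < k₅) (h45h : k₅ ≤ 2 * k₄) (hk5K : k₅ < K)
    (hLa : ∀ l, l < K → l ≠ 1 → l ≠ k₂ → l ≠ k₃ → l ≠ k₄ → l ≠ k₅ → L l = 0)
    {N : ℕ} {KL : ℕ → ℕ → ℕ → ℝ}
    (hKL : ∀ k n l, KL k n l = if 0 < k ∧ k < K ∧ l < k then L k * h (n + k) ^ 3 / 2 * ∏ t ∈ Ico (n + 1 + l) (n + k + 1), g t else 0)
    {KA : ℕ → ℕ → ℕ → ℝ} {RA : ℕ → (ℕ → ℝ) → ℕ → ℝ}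
    (hRA : ∀ i v m, RA i v m = ∑ l ∈ range K, KA i m l * v (m + 1 + l))
    (hKA : ∀ i m l, KA i m l = KL i m l + KA (i + 1) m l) (hKAtop : ∀ m l, KA K m l = 0)
    {e ε : ℕ → ℝ} (he0 : ∀ m, 0 ≤ e m) (hea : ∀ m, e (m + 1) ≤ e m)
    (hεt : ∀ m, N < m → ε m = 0) (hεrec : ∀ m, ε m = e m - RA 1 ε m) : ∀ m, 0 ≤ ε m ∧ ε m ≤ e m :=
  flow_nonneg_census_young_pair_old_triple_of_cap hmono hL hb hlo hdom hh hf hg hgF hk2 hk29 (by omega) (by omega) (by omega) hk5K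
    (s := 19 / 25) (κ := 1 / 1000) (ρ₀ := 64) (by norm_num) (by norm_num) (by norm_num) (by norm_num) (by norm_num) hk3
    (fun q => old_triple_load_le_c42 hmono hL hb hlo hdom hh hf (by omega) h34l h34h h45l h45h hk5K q) hLa hKL hRA hKA hKAtop he0 hea hεt hεrec

/-- **THE CENSUS FIVE AGES `{1, k₂, k₃, k₄, k₅}` ON THE CELL `k₄∕k₃ ∈ (2,3]`, `k₅∕k₄ ∈ (2,3]`:** `2 ≤ k₂ ≤ 29`, `64·k₂ ≤ k₃`: `0 ≤ ε ≤ e` at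
every pin, every horizon, every damping of the self-consistent class (§1 with the triple cap `19 / 25` of `old_triple_load_le_c33`, `κ = 1∕1000`,
`ρ₀ = 64`). [folklore] -/
theorem flow_nonneg_census_five_ages_c33
    (hmono : ∀ u v : ℕ → ℝ, SeqBox γ u → SeqBox γ v → (∀ j, u j ≤ v j) → B u ≤ B v)
    (hL : ∀ k, 0 ≤ L k) (hb : 0 < b) (hlo : ∀ u, SeqBox γ u → b ≤ B u) (hdom : ∀ u, SeqBox γ u → ∑ k ∈ range K, L k * u k ≤ B u)
    (hh : SeqBox γ h) (hf : MemFlow B gIR h) (hg : ∀ t, 0 < g t ∧ g t ≤ 1)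
    (hgF : ∀ t, 1 ≤ g t * (1 + ∑ k ∈ range K, L k * h (t + k) ^ 3 / 2))
    {k₂ k₃ k₄ k₅ : ℕ} (hk2 : 2 ≤ k₂) (hk29 : k₂ ≤ 29) (hk3 : 64 * k₂ ≤ k₃)
    (h34l : 2 * k₃ < k₄) (h34h : k₄ ≤ 3 * k₃) (h45l : 2 * k₄ < k₅) (h45h : k₅ ≤ 3 * k₄) (hk5K : k₅ < K)
    (hLa : ∀ l, l < K → l ≠ 1 → l ≠ k₂ → l ≠ k₃ → l ≠ k₄ → l ≠ k₅ → L l = 0)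
    {N : ℕ} {KL : ℕ → ℕ → ℕ → ℝ}
    (hKL : ∀ k n l, KL k n l = if 0 < k ∧ k < K ∧ l < k then L k * h (n + k) ^ 3 / 2 * ∏ t ∈ Ico (n + 1 + l) (n + k + 1), g t else 0)
    {KA : ℕ → ℕ → ℕ → ℝ} {RA : ℕ → (ℕ → ℝ) → ℕ → ℝ}
    (hRA : ∀ i v m, RA i v m = ∑ l ∈ range K, KA i m l * v (m + 1 + l))
    (hKA : ∀ i m l, KA i m l = KL i m l + KA (i + 1) m l) (hKAtop : ∀ m l, KA K m l = 0)
    {e ε : ℕ → ℝ} (he0 : ∀ m, 0 ≤ e m) (hea : ∀ m, e (m + 1) ≤ e m)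
    (hεt : ∀ m, N < m → ε m = 0) (hεrec : ∀ m, ε m = e m - RA 1 ε m) : ∀ m, 0 ≤ ε m ∧ ε m ≤ e m :=
  flow_nonneg_census_young_pair_old_triple_of_cap hmono hL hb hlo hdom hh hf hg hgF hk2 hk29 (by omega) (by omega) (by omega) hk5K
    (s := 19 / 25) (κ := 1 / 1000) (ρ₀ := 64) (by norm_num) (by norm_num) (by norm_num) (by norm_num) (by norm_num) hk3
    (fun q => old_triple_load_le_c33 hmono hL hb hlo hdom hh hf (by omega) h34l h34h h45l h45h hk5K q) hLa hKL hRA hKA hKAtop he0 hea hεt hεrec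

/-- **THE CENSUS FIVE AGES `{1, k₂, k₃, k₄, k₅}` ON THE CELL `k₄∕k₃ ∈ (2,3]`, `k₅∕k₄ ∈ (3,4]`:** `2 ≤ k₂ ≤ 29`, `68·k₂ ≤ k₃`: `0 ≤ ε ≤ e` at
every pin, every horizon, every damping of the self-consistent class (§1 with the triple cap `77 / 100` of `old_triple_load_le_c34`, `κ = 1∕1000`,
`ρ₀ = 68`). [folklore] -/
theorem flow_nonneg_census_five_ages_c34
    (hmono : ∀ u v : ℕ → ℝ, SeqBox γ u → SeqBox γ v → (∀ j, u j ≤ v j) → B u ≤ B v)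
    (hL : ∀ k, 0 ≤ L k) (hb : 0 < b) (hlo : ∀ u, SeqBox γ u → b ≤ B u) (hdom : ∀ u, SeqBox γ u → ∑ k ∈ range K, L k * u k ≤ B u)
    (hh : SeqBox γ h) (hf : MemFlow B gIR h) (hg : ∀ t, 0 < g t ∧ g t ≤ 1)
    (hgF : ∀ t, 1 ≤ g t * (1 + ∑ k ∈ range K, L k * h (t + k) ^ 3 / 2))
    {k₂ k₃ k₄ k₅ : ℕ} (hk2 : 2 ≤ k₂) (hk29 : k₂ ≤ 29) (hk3 : 68 * k₂ ≤ k₃)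
    (h34l : 2 * k₃ < k₄) (h34h : k₄ ≤ 3 * k₃) (h45l : 3 * k₄ < k₅) (h45h : k₅ ≤ 4 * k₄) (hk5K : k₅ < K)
    (hLa : ∀ l, l < K → l ≠ 1 → l ≠ k₂ → l ≠ k₃ → l ≠ k₄ → l ≠ k₅ → L l = 0)
    {N : ℕ} {KL : ℕ → ℕ → ℕ → ℝ}
    (hKL : ∀ k n l, KL k n l = if 0 < k ∧ k < K ∧ l < k then L k * h (n + k) ^ 3 / 2 * ∏ t ∈ Ico (n + 1 + l) (n + k + 1), g t else 0)
    {KA : ℕ → ℕ → ℕ → ℝ} {RA : ℕ → (ℕ → ℝ) → ℕ → ℝ}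
    (hRA : ∀ i v m, RA i v m = ∑ l ∈ range K, KA i m l * v (m + 1 + l))
    (hKA : ∀ i m l, KA i m l = KL i m l + KA (i + 1) m l) (hKAtop : ∀ m l, KA K m l = 0)
    {e ε : ℕ → ℝ} (he0 : ∀ m, 0 ≤ e m) (hea : ∀ m, e (m + 1) ≤ e m)
    (hεt : ∀ m, N < m → ε m = 0) (hεrec : ∀ m, ε m = e m - RA 1 ε m) : ∀ m, 0 ≤ ε m ∧ ε m ≤ e m :=
  flow_nonneg_census_young_pair_old_triple_of_cap hmono hL hb hlo hdom hh hf hg hgF hk2 hk29 (by omega) (by omega) (by omega) hk5K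
    (s := 77 / 100) (κ := 1 / 1000) (ρ₀ := 68) (by norm_num) (by norm_num) (by norm_num) (by norm_num) (by norm_num) hk3
    (fun q => old_triple_load_le_c34 hmono hL hb hlo hdom hh hf (by omega) h34l h34h h45l h45h hk5K q) hLa hKL hRA hKA hKAtop he0 hea hεt hεrec

/-- **THE CENSUS FIVE AGES `{1, k₂, k₃, k₄, k₅}` ON THE CELL `k₄∕k₃ ∈ (3,4]`, `k₅∕k₄ ∈ (2,3]`:** `2 ≤ k₂ ≤ 29`, `68·k₂ ≤ k₃`: `0 ≤ ε ≤ e` at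
every pin, every horizon, every damping of the self-consistent class (§1 with the triple cap `77 / 100` of `old_triple_load_le_c43`, `κ = 1∕1000`,
`ρ₀ = 68`). [folklore] -/
theorem flow_nonneg_census_five_ages_c43
    (hmono : ∀ u v : ℕ → ℝ, SeqBox γ u → SeqBox γ v → (∀ j, u j ≤ v j) → B u ≤ B v)
    (hL : ∀ k, 0 ≤ L k) (hb : 0 < b) (hlo : ∀ u, SeqBox γ u → b ≤ B u) (hdom : ∀ u, SeqBox γ u → ∑ k ∈ range K, L k * u k ≤ B u)
    (hh : SeqBox γ h) (hf : MemFlow B gIR h) (hg : ∀ t, 0 < g t ∧ g t ≤ 1)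
    (hgF : ∀ t, 1 ≤ g t * (1 + ∑ k ∈ range K, L k * h (t + k) ^ 3 / 2))
    {k₂ k₃ k₄ k₅ : ℕ} (hk2 : 2 ≤ k₂) (hk29 : k₂ ≤ 29) (hk3 : 68 * k₂ ≤ k₃)
    (h34l : 3 * k₃ < k₄) (h34h : k₄ ≤ 4 * k₃) (h45l : 2 * k₄ < k₅) (h45h : k₅ ≤ 3 * k₄) (hk5K : k₅ < K)
    (hLa : ∀ l, l < K → l ≠ 1 → l ≠ k₂ → l ≠ k₃ → l ≠ k₄ → l ≠ k₅ → L l = 0)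
    {N : ℕ} {KL : ℕ → ℕ → ℕ → ℝ}
    (hKL : ∀ k n l, KL k n l = if 0 < k ∧ k < K ∧ l < k then L k * h (n + k) ^ 3 / 2 * ∏ t ∈ Ico (n + 1 + l) (n + k + 1), g t else 0)
    {KA : ℕ → ℕ → ℕ → ℝ} {RA : ℕ → (ℕ → ℝ) → ℕ → ℝ}
    (hRA : ∀ i v m, RA i v m = ∑ l ∈ range K, KA i m l * v (m + 1 + l))
    (hKA : ∀ i m l, KA i m l = KL i m l + KA (i + 1) m l) (hKAtop : ∀ m l, KA K m l = 0)
    {e ε : ℕ → ℝ} (he0 : ∀ m, 0 ≤ e m) (hea : ∀ m, e (m + 1) ≤ e m)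
    (hεt : ∀ m, N < m → ε m = 0) (hεrec : ∀ m, ε m = e m - RA 1 ε m) : ∀ m, 0 ≤ ε m ∧ ε m ≤ e m :=
  flow_nonneg_census_young_pair_old_triple_of_cap hmono hL hb hlo hdom hh hf hg hgF hk2 hk29 (by omega) (by omega) (by omega) hk5K
    (s := 77 / 100) (κ := 1 / 1000) (ρ₀ := 68) (by norm_num) (by norm_num) (by norm_num) (by norm_num) (by norm_num) hk3
    (fun q => old_triple_load_le_c43 hmono hL hb hlo hdom hh hf (by omega) h34l h34h h45l h45h hk5K q) hLa hKL hRA hKA hKAtop he0 hea hεt hεrec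

/-- **THE CENSUS FIVE AGES `{1, k₂, k₃, k₄, k₅}` ON THE CELL `k₄∕k₃ ∈ (3,4]`, `k₅∕k₄ ∈ (3,4]`:** `2 ≤ k₂ ≤ 29`, `68·k₂ ≤ k₃`: `0 ≤ ε ≤ e` at
every pin, every horizon, every damping of the self-consistent class (§1 with the triple cap `77 / 100` of `old_triple_load_le_c44`, `κ = 1∕1000`,
`ρ₀ = 68`). [folklore] -/
theorem flow_nonneg_census_five_ages_c44
    (hmono : ∀ u v : ℕ → ℝ, SeqBox γ u → SeqBox γ v → (∀ j, u j ≤ v j) → B u ≤ B v)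
    (hL : ∀ k, 0 ≤ L k) (hb : 0 < b) (hlo : ∀ u, SeqBox γ u → b ≤ B u) (hdom : ∀ u, SeqBox γ u → ∑ k ∈ range K, L k * u k ≤ B u)
    (hh : SeqBox γ h) (hf : MemFlow B gIR h) (hg : ∀ t, 0 < g t ∧ g t ≤ 1)
    (hgF : ∀ t, 1 ≤ g t * (1 + ∑ k ∈ range K, L k * h (t + k) ^ 3 / 2))
    {k₂ k₃ k₄ k₅ : ℕ} (hk2 : 2 ≤ k₂) (hk29 : k₂ ≤ 29) (hk3 : 68 * k₂ ≤ k₃)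
    (h34l : 3 * k₃ < k₄) (h34h : k₄ ≤ 4 * k₃) (h45l : 3 * k₄ < k₅) (h45h : k₅ ≤ 4 * k₄) (hk5K : k₅ < K)
    (hLa : ∀ l, l < K → l ≠ 1 → l ≠ k₂ → l ≠ k₃ → l ≠ k₄ → l ≠ k₅ → L l = 0)
    {N : ℕ} {KL : ℕ → ℕ → ℕ → ℝ}
    (hKL : ∀ k n l, KL k n l = if 0 < k ∧ k < K ∧ l < k then L k * h (n + k) ^ 3 / 2 * ∏ t ∈ Ico (n + 1 + l) (n + k + 1), g t else 0)
    {KA : ℕ → ℕ → ℕ → ℝ} {RA : ℕ → (ℕ → ℝ) → ℕ → ℝ}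
    (hRA : ∀ i v m, RA i v m = ∑ l ∈ range K, KA i m l * v (m + 1 + l))
    (hKA : ∀ i m l, KA i m l = KL i m l + KA (i + 1) m l) (hKAtop : ∀ m l, KA K m l = 0)
    {e ε : ℕ → ℝ} (he0 : ∀ m, 0 ≤ e m) (hea : ∀ m, e (m + 1) ≤ e m)
    (hεt : ∀ m, N < m → ε m = 0) (hεrec : ∀ m, ε m = e m - RA 1 ε m) : ∀ m, 0 ≤ ε m ∧ ε m ≤ e m :=
  flow_nonneg_census_young_pair_old_triple_of_cap hmono hL hb hlo hdom hh hf hg hgF hk2 hk29 (by omega) (by omega) (by omega) hk5K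
    (s := 77 / 100) (κ := 1 / 1000) (ρ₀ := 68) (by norm_num) (by norm_num) (by norm_num) (by norm_num) (by norm_num) hk3
    (fun q => old_triple_load_le_c44 hmono hL hb hlo hdom hh hf (by omega) h34l h34h h45l h45h hk5K q) hLa hKL hRA hKA hKAtop he0 hea hεt hεrec

/-! ## §3 Both top ratios at most 4 -/

/-- **THE CENSUS FIVE AGES, BOTH TOP RATIOS AT MOST 4.**  `2 ≤ k₂ ≤ 29`, `68k₂ ≤ k₃`, `k₃ < k₄ ≤ 4k₃`, `k₄ < k₅ ≤ 4k₄`, `k₅ < K`: `0 ≤ ε ≤ e` at every pin,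
every horizon, every damping of the self-consistent class (the nine cells of §2). [folklore] -/
theorem flow_nonneg_census_five_ages_top4
    (hmono : ∀ u v : ℕ → ℝ, SeqBox γ u → SeqBox γ v → (∀ j, u j ≤ v j) → B u ≤ B v)
    (hL : ∀ k, 0 ≤ L k) (hb : 0 < b) (hlo : ∀ u, SeqBox γ u → b ≤ B u) (hdom : ∀ u, SeqBox γ u → ∑ k ∈ range K, L k * u k ≤ B u)
    (hh : SeqBox γ h) (hf : MemFlow B gIR h) (hg : ∀ t, 0 < g t ∧ g t ≤ 1)
    (hgF : ∀ t, 1 ≤ g t * (1 + ∑ k ∈ range K, L k * h (t + k) ^ 3 / 2))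
    {k₂ k₃ k₄ k₅ : ℕ} (hk2 : 2 ≤ k₂) (hk29 : k₂ ≤ 29) (hk3 : 68 * k₂ ≤ k₃)
    (h34l : k₃ < k₄) (h34h : k₄ ≤ 4 * k₃) (h45l : k₄ < k₅) (h45h : k₅ ≤ 4 * k₄) (hk5K : k₅ < K)
    (hLa : ∀ l, l < K → l ≠ 1 → l ≠ k₂ → l ≠ k₃ → l ≠ k₄ → l ≠ k₅ → L l = 0)
    {N : ℕ} {KL : ℕ → ℕ → ℕ → ℝ}
    (hKL : ∀ k n l, KL k n l = if 0 < k ∧ k < K ∧ l < k then L k * h (n + k) ^ 3 / 2 * ∏ t ∈ Ico (n + 1 + l) (n + k + 1), g t else 0)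
    {KA : ℕ → ℕ → ℕ → ℝ} {RA : ℕ → (ℕ → ℝ) → ℕ → ℝ}
    (hRA : ∀ i v m, RA i v m = ∑ l ∈ range K, KA i m l * v (m + 1 + l))
    (hKA : ∀ i m l, KA i m l = KL i m l + KA (i + 1) m l) (hKAtop : ∀ m l, KA K m l = 0)
    {e ε : ℕ → ℝ} (he0 : ∀ m, 0 ≤ e m) (hea : ∀ m, e (m + 1) ≤ e m)
    (hεt : ∀ m, N < m → ε m = 0) (hεrec : ∀ m, ε m = e m - RA 1 ε m) : ∀ m, 0 ≤ ε m ∧ ε m ≤ e m := by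
  rcases le_or_gt k₄ (2 * k₃) with ha | ha
  · rcases le_or_gt k₅ (2 * k₄) with hb' | hb'
    · exact flow_nonneg_census_five_ages_c22 hmono hL hb hlo hdom hh hf hg hgF hk2 hk29 (by omega) (by omega) ha (by omega) hb' hk5K hLa
        hKL hRA hKA hKAtop he0 hea hεt hεrec
    rcases le_or_gt k₅ (3 * k₄) with hc | hc
    · exact flow_nonneg_census_five_ages_c23 hmono hL hb hlo hdom hh hf hg hgF hk2 hk29 (by omega) (by omega) ha (by omega) hc hk5K hLa
        hKL hRA hKA hKAtop he0 hea hεt hεrec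
    · exact flow_nonneg_census_five_ages_c24 hmono hL hb hlo hdom hh hf hg hgF hk2 hk29 (by omega) (by omega) ha (by omega) h45h hk5K hLa
        hKL hRA hKA hKAtop he0 hea hεt hεrec
  rcases le_or_gt k₄ (3 * k₃) with ha2 | ha2
  · rcases le_or_gt k₅ (2 * k₄) with hb' | hb'
    · exact flow_nonneg_census_five_ages_c32 hmono hL hb hlo hdom hh hf hg hgF hk2 hk29 (by omega) (by omega) ha2 (by omega) hb' hk5K hLa
        hKL hRA hKA hKAtop he0 hea hεt hεrec
    rcases le_or_gt k₅ (3 * k₄) with hc | hc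
    · exact flow_nonneg_census_five_ages_c33 hmono hL hb hlo hdom hh hf hg hgF hk2 hk29 (by omega) (by omega) ha2 (by omega) hc hk5K hLa
        hKL hRA hKA hKAtop he0 hea hεt hεrec
    · exact flow_nonneg_census_five_ages_c34 hmono hL hb hlo hdom hh hf hg hgF hk2 hk29 (by omega) (by omega) ha2 (by omega) h45h hk5K hLa
        hKL hRA hKA hKAtop he0 hea hεt hεrec
  · rcases le_or_gt k₅ (2 * k₄) with hb' | hb'
    · exact flow_nonneg_census_five_ages_c42 hmono hL hb hlo hdom hh hf hg hgF hk2 hk29 (by omega) (by omega) h34h (by omega) hb' hk5K hLa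
        hKL hRA hKA hKAtop he0 hea hεt hεrec
    rcases le_or_gt k₅ (3 * k₄) with hc | hc
    · exact flow_nonneg_census_five_ages_c43 hmono hL hb hlo hdom hh hf hg hgF hk2 hk29 (by omega) (by omega) h34h (by omega) hc hk5K hLa
        hKL hRA hKA hKAtop he0 hea hεt hεrec
    · exact flow_nonneg_census_five_ages_c44 hmono hL hb hlo hdom hh hf hg hgF hk2 hk29 (by omega) (by omega) h34h (by omega) h45h hk5K hLa
        hKL hRA hKA hKAtop he0 hea hεt hεrec

end Summit.QuantumFields.BalabanUV.Beta.EriceRemainderEnclosureHistoryAutonomyComparisonAgeCompositionFiveAgesOneBlock
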